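import Summits.CriticalPhenomena.PercolationContinuityZ3.Theorems.PercNearOneGluingNoHeavyLowerTailSahiE3ExchangeDomPrincipal
import Mathlib.Data.Fintype.Powerset
import Mathlib.Data.Fintype.Pi
import Mathlib.Data.Fin.VecNotation
import Mathlib.Tactic.Linarith
import Mathlib.Tactic.Ring
import Mathlib.Tactic
import HarnessLib
import HarnessLib.Audit

/-!
# `NoHeavyLowerTail` (crux stmt-CriticalPhenomena-4575), Sahi programme P4: the flagship block `x₀ ∧ (x₁ ∨ x₂)` — combinatorial and measure plumbing

Support file (cell `prim-l12`, seat P4, generation 23; `--supports stmt-CriticalPhenomena-4575`).  No named facts, no sorries;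
standard axioms; def-free (every object is a literal `Finset (Fin 3 → Bool)` or a hypothesis).

Purpose (HOME prim-l12-p4/FROM-prim-l12-p4-gen23-FLAGSHIP-LEVEL0.md §6).  The level-`∅` exchange lemma for the block
`V = x₀∧(x₁∨x₂) ⊂ Bool³` is assembled from the abstract lemmas (`exchange_of_noCross₂/₁`, `exchange_of_emptyLayer*`,
`exchange_of_hats` + `andorPolyNN_nonneg`, `exchange_antisym`) by a case split on the TRACES `X ∩ V` of the configuration's
up-sets.  This file provides the finite facts that plumbing needs, all by `decide` over the 256 subsets of the cube or by
direct computation with the product weight `μ(x) = (A|1−A)(b|1−b)(c|1−c)`: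
* `upF_iff` — the coordinatewise spelling of "up-closed" (decidable) versus the order spelling used by `harris_upsets`;
* `trace_cases` — an up-closed `S` has `S ∩ V ∈ {∅, {111}, {110,111}, {101,111}, V}`;
* `eq_empty_of_trace_empty`, `subset_hat_top/T1/T2` — the saturations ("hats"): trace `{111}` forces `S ⊆ {x₁x₂}`,
  trace `{110,111}` forces `S ⊆ {x₁}`, trace `{101,111}` forces `S ⊆ {x₂}`, empty trace forces `S = ∅`;
* `V_up`, `hatTop_up`, `hatT1_up`, `hatT2_up` — these literal sets are up-closed;
* `pw_nonneg`, `pw_sum_univ`, `pw_logmod` — the product weight is a log-modular probability;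
* `harris_inter_V`, `harris_plain` — Harris' inequality for up-closed sets under `μ`, in the two shapes the abstract lemmas take;
* `mass_*` — the masses of the traces and hats: `A·b·c, A·b, A·c, A(b+c−bc), b·c, b, c`.
Points are `x : Fin 3 → Bool` (`x 0 = x₀`, `x 1 = x₁`, `x 2 = x₂`), written `![x₀, x₁, x₂]`.
-/

set_option maxRecDepth 400000

namespace Summit.CriticalPhenomena.PercolationContinuityZ3.Theorems.SahiE3AndOrBlock

open Finset SahiE3ExchangeDomPrincipal
open scoped BigOperators

/-! ## Up-closed sets of the cube: the two spellings -/

/-- Coordinatewise spelling of the order on the cube. [this work] -/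
theorem le_iff_imp (a b : Fin 3 → Bool) : a ≤ b ↔ ∀ i, a i = true → b i = true := by
  simp only [Pi.le_def, Bool.le_iff_imp]

/-- "Up-closed" in the decidable coordinatewise spelling is "up-closed" in the order spelling. [this work] -/
theorem upF_iff (S : Finset (Fin 3 → Bool)) :
    (∀ a ∈ S, ∀ b : Fin 3 → Bool, (∀ i, a i = true → b i = true) → b ∈ S) ↔ (∀ a ∈ S, ∀ b : Fin 3 → Bool, a ≤ b → b ∈ S) := by
  simp only [le_iff_imp]

/-! ## Trace classification and hats (by `decide` over the 256 subsets of the cube) -/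

/-- Decidable form of `trace_cases` (coordinatewise up-closedness), proved by `decide`. [this work] -/
private theorem trace_cases_dec : ∀ S : Finset (Fin 3 → Bool),
    (∀ a ∈ S, ∀ b : Fin 3 → Bool, (∀ i, a i = true → b i = true) → b ∈ S) →
    S ∩ {![true, true, false], ![true, false, true], ![true, true, true]} = ∅ ∨
    S ∩ {![true, true, false], ![true, false, true], ![true, true, true]} = {![true, true, true]} ∨
    S ∩ {![true, true, false], ![true, false, true], ![true, true, true]} = {![true, true, false], ![true, true, true]} ∨
    S ∩ {![true, true, false], ![true, false, true], ![true, true, true]} = {![true, false, true], ![true, true, true]} ∨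
    S ∩ {![true, true, false], ![true, false, true], ![true, true, true]} =
      {![true, true, false], ![true, false, true], ![true, true, true]} := by
  decide

/-- **Trace classification.**  An up-closed subset of the cube meets `V = {110, 101, 111}` in one of the five traces
`∅, {111}, {110,111}, {101,111}, V`. [this work] -/
theorem trace_cases (S : Finset (Fin 3 → Bool)) (hS : ∀ a ∈ S, ∀ b : Fin 3 → Bool, a ≤ b → b ∈ S) :
    S ∩ {![true, true, false], ![true, false, true], ![true, true, true]} = ∅ ∨
    S ∩ {![true, true, false], ![true, false, true], ![true, true, true]} = {![true, true, true]} ∨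
    S ∩ {![true, true, false], ![true, false, true], ![true, true, true]} = {![true, true, false], ![true, true, true]} ∨
    S ∩ {![true, true, false], ![true, false, true], ![true, true, true]} = {![true, false, true], ![true, true, true]} ∨
    S ∩ {![true, true, false], ![true, false, true], ![true, true, true]} =
      {![true, true, false], ![true, false, true], ![true, true, true]} :=
  trace_cases_dec S ((upF_iff S).2 hS)

/-- Decidable form of `eq_empty_of_trace_empty`, proved by `decide`. [this work] -/
private theorem eq_empty_of_trace_empty_dec : ∀ S : Finset (Fin 3 → Bool),
    (∀ a ∈ S, ∀ b : Fin 3 → Bool, (∀ i, a i = true → b i = true) → b ∈ S) →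
    (S ∩ {![true, true, false], ![true, false, true], ![true, true, true]} ≠ ∅ ∨ S = ∅) := by
  decide

/-- Empty trace forces the empty set (every non-empty up-set contains `111 ∈ V`). [this work] -/
theorem eq_empty_of_trace_empty (S : Finset (Fin 3 → Bool)) (hS : ∀ a ∈ S, ∀ b : Fin 3 → Bool, a ≤ b → b ∈ S)
    (hT : S ∩ {![true, true, false], ![true, false, true], ![true, true, true]} = ∅) : S = ∅ :=
  ((eq_empty_of_trace_empty_dec S ((upF_iff S).2 hS)).resolve_left (not_not.2 hT))

/-- Decidable form of `subset_hat_top`, proved by `decide`. [this work] -/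
private theorem subset_hat_top_dec : ∀ S : Finset (Fin 3 → Bool),
    (∀ a ∈ S, ∀ b : Fin 3 → Bool, (∀ i, a i = true → b i = true) → b ∈ S) →
    (S ∩ {![true, true, false], ![true, false, true], ![true, true, true]} ≠ {![true, true, true]} ∨
    S ⊆ {![false, true, true], ![true, true, true]}) := by
  decide

/-- Trace `{111}` forces `S ⊆ {x₁ ∧ x₂} = {011, 111}` (the hat of the top trace). [this work] -/
theorem subset_hat_top (S : Finset (Fin 3 → Bool)) (hS : ∀ a ∈ S, ∀ b : Fin 3 → Bool, a ≤ b → b ∈ S)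
    (hT : S ∩ {![true, true, false], ![true, false, true], ![true, true, true]} = {![true, true, true]}) :
    S ⊆ {![false, true, true], ![true, true, true]} :=
  ((subset_hat_top_dec S ((upF_iff S).2 hS)).resolve_left (not_not.2 hT))

/-- Decidable form of `subset_hat_T1`, proved by `decide`. [this work] -/
private theorem subset_hat_T1_dec : ∀ S : Finset (Fin 3 → Bool),
    (∀ a ∈ S, ∀ b : Fin 3 → Bool, (∀ i, a i = true → b i = true) → b ∈ S) →
    (S ∩ {![true, true, false], ![true, false, true], ![true, true, true]} ≠ {![true, true, false], ![true, true, true]} ∨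
    S ⊆ {![false, true, false], ![true, true, false], ![false, true, true], ![true, true, true]}) := by
  decide

/-- Trace `{110, 111}` forces `S ⊆ {x₁} = {010, 110, 011, 111}`. [this work] -/
theorem subset_hat_T1 (S : Finset (Fin 3 → Bool)) (hS : ∀ a ∈ S, ∀ b : Fin 3 → Bool, a ≤ b → b ∈ S)
    (hT : S ∩ {![true, true, false], ![true, false, true], ![true, true, true]} = {![true, true, false], ![true, true, true]}) :
    S ⊆ {![false, true, false], ![true, true, false], ![false, true, true], ![true, true, true]} :=
  ((subset_hat_T1_dec S ((upF_iff S).2 hS)).resolve_left (not_not.2 hT))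

/-- Decidable form of `subset_hat_T2`, proved by `decide`. [this work] -/
private theorem subset_hat_T2_dec : ∀ S : Finset (Fin 3 → Bool),
    (∀ a ∈ S, ∀ b : Fin 3 → Bool, (∀ i, a i = true → b i = true) → b ∈ S) →
    (S ∩ {![true, true, false], ![true, false, true], ![true, true, true]} ≠ {![true, false, true], ![true, true, true]} ∨
    S ⊆ {![false, false, true], ![true, false, true], ![false, true, true], ![true, true, true]}) := by
  decide

/-- Trace `{101, 111}` forces `S ⊆ {x₂} = {001, 101, 011, 111}`. [this work] -/
theorem subset_hat_T2 (S : Finset (Fin 3 → Bool)) (hS : ∀ a ∈ S, ∀ b : Fin 3 → Bool, a ≤ b → b ∈ S)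
    (hT : S ∩ {![true, true, false], ![true, false, true], ![true, true, true]} = {![true, false, true], ![true, true, true]}) :
    S ⊆ {![false, false, true], ![true, false, true], ![false, true, true], ![true, true, true]} :=
  ((subset_hat_T2_dec S ((upF_iff S).2 hS)).resolve_left (not_not.2 hT))

/-- `V = {110, 101, 111}` is up-closed. [this work] -/
theorem V_up : ∀ a ∈ ({![true, true, false], ![true, false, true], ![true, true, true]} : Finset (Fin 3 → Bool)),
    ∀ b : Fin 3 → Bool, a ≤ b → b ∈ ({![true, true, false], ![true, false, true], ![true, true, true]} : Finset (Fin 3 → Bool)) :=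
  (upF_iff _).1 (by decide)

/-- The hat `{011, 111}` of the top trace is up-closed. [this work] -/
theorem hatTop_up : ∀ a ∈ ({![false, true, true], ![true, true, true]} : Finset (Fin 3 → Bool)),
    ∀ b : Fin 3 → Bool, a ≤ b → b ∈ ({![false, true, true], ![true, true, true]} : Finset (Fin 3 → Bool)) :=
  (upF_iff _).1 (by decide)

/-- The hat `{x₁}` is up-closed. [this work] -/
theorem hatT1_up : ∀ a ∈ ({![false, true, false], ![true, true, false], ![false, true, true], ![true, true, true]} : Finset (Fin 3 → Bool)),
    ∀ b : Fin 3 → Bool, a ≤ b →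
      b ∈ ({![false, true, false], ![true, true, false], ![false, true, true], ![true, true, true]} : Finset (Fin 3 → Bool)) :=
  (upF_iff _).1 (by decide)

/-- The hat `{x₂}` is up-closed. [this work] -/
theorem hatT2_up : ∀ a ∈ ({![false, false, true], ![true, false, true], ![false, true, true], ![true, true, true]} : Finset (Fin 3 → Bool)),
    ∀ b : Fin 3 → Bool, a ≤ b →
      b ∈ ({![false, false, true], ![true, false, true], ![false, true, true], ![true, true, true]} : Finset (Fin 3 → Bool)) :=
  (upF_iff _).1 (by decide)

/-- Intersections of up-closed sets are up-closed. [this work] -/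
theorem inter_up (X Y : Finset (Fin 3 → Bool)) (hX : ∀ a ∈ X, ∀ b : Fin 3 → Bool, a ≤ b → b ∈ X)
    (hY : ∀ a ∈ Y, ∀ b : Fin 3 → Bool, a ≤ b → b ∈ Y) : ∀ a ∈ X ∩ Y, ∀ b : Fin 3 → Bool, a ≤ b → b ∈ X ∩ Y := by
  intro a ha b hab
  rw [Finset.mem_inter] at ha ⊢
  exact ⟨hX a ha.1 b hab, hY a ha.2 b hab⟩

/-! ## The product weight -/

/-- The product weight is nonnegative for parameters in `[0,1]`. [this work] -/
theorem pw_nonneg (A b c : ℝ) (hA0 : 0 ≤ A) (hA1 : A ≤ 1) (hb0 : 0 ≤ b) (hb1 : b ≤ 1) (hc0 : 0 ≤ c) (hc1 : c ≤ 1)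
    (μ : (Fin 3 → Bool) → ℝ)
    (hμ : ∀ x, μ x = (if x 0 then A else 1 - A) * ((if x 1 then b else 1 - b) * (if x 2 then c else 1 - c))) :
    ∀ x, 0 ≤ μ x := by
  intro x; rw [hμ]
  refine mul_nonneg ?_ (mul_nonneg ?_ ?_) <;> split_ifs <;> linarith

/-- The product weight has total mass `1`. [this work] -/
theorem pw_sum_univ (A b c : ℝ) (μ : (Fin 3 → Bool) → ℝ)
    (hμ : ∀ x, μ x = (if x 0 then A else 1 - A) * ((if x 1 then b else 1 - b) * (if x 2 then c else 1 - c))) :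
    ∑ x, μ x = 1 := by
  have huniv : (Finset.univ : Finset (Fin 3 → Bool)) = {![false, false, false], ![true, false, false], ![false, true, false],
      ![true, true, false], ![false, false, true], ![true, false, true], ![false, true, true], ![true, true, true]} := by decide
  rw [huniv, Finset.sum_insert (by decide), Finset.sum_insert (by decide), Finset.sum_insert (by decide),
    Finset.sum_insert (by decide), Finset.sum_insert (by decide), Finset.sum_insert (by decide),
    Finset.sum_insert (by decide), Finset.sum_singleton]
  simp only [hμ]
  simp
  ring

/-- The product weight is log-modular (hence log-supermodular, the FKG hypothesis). [this work] -/
theorem pw_logmod (A b c : ℝ) (μ : (Fin 3 → Bool) → ℝ)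
    (hμ : ∀ x, μ x = (if x 0 then A else 1 - A) * ((if x 1 then b else 1 - b) * (if x 2 then c else 1 - c))) :
    ∀ x y, μ x * μ y ≤ μ (x ⊓ y) * μ (x ⊔ y) := by
  intro x y
  apply le_of_eq
  rw [hμ x, hμ y, hμ (x ⊓ y), hμ (x ⊔ y)]
  simp only [Pi.inf_apply, Pi.sup_apply]
  rcases Bool.eq_false_or_eq_true (x 0) with h0 | h0 <;> rcases Bool.eq_false_or_eq_true (x 1) with h1 | h1 <;>
  rcases Bool.eq_false_or_eq_true (x 2) with h2 | h2 <;> rcases Bool.eq_false_or_eq_true (y 0) with h3 | h3 <;>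
  rcases Bool.eq_false_or_eq_true (y 1) with h4 | h4 <;> rcases Bool.eq_false_or_eq_true (y 2) with h5 | h5 <;>
  simp [h0, h1, h2, h3, h4, h5] <;> ring

/-! ## Harris' inequality on the cube, in the shapes the abstract exchange lemmas take -/

/-- **Harris (plain).**  For up-closed `X, Y` under the product weight: `μ(X)·μ(Y) ≤ μ(X ∩ Y)`. [this work] -/
theorem harris_plain (A b c : ℝ) (hA0 : 0 ≤ A) (hA1 : A ≤ 1) (hb0 : 0 ≤ b) (hb1 : b ≤ 1) (hc0 : 0 ≤ c) (hc1 : c ≤ 1)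
    (μ : (Fin 3 → Bool) → ℝ)
    (hμ : ∀ x, μ x = (if x 0 then A else 1 - A) * ((if x 1 then b else 1 - b) * (if x 2 then c else 1 - c)))
    (X Y : Finset (Fin 3 → Bool)) (hX : ∀ a ∈ X, ∀ b : Fin 3 → Bool, a ≤ b → b ∈ X)
    (hY : ∀ a ∈ Y, ∀ b : Fin 3 → Bool, a ≤ b → b ∈ Y) :
    (∑ x ∈ X, μ x) * (∑ x ∈ Y, μ x) ≤ ∑ x ∈ X ∩ Y, μ x := by
  have h := harris_upsets μ (pw_nonneg A b c hA0 hA1 hb0 hb1 hc0 hc1 μ hμ) (pw_logmod A b c μ hμ) X Y hX hY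
  rwa [pw_sum_univ A b c μ hμ, one_mul] at h

/-- **Harris (traced form).**  For up-closed `X, Y`: `μ(X)·μ(Y ∩ V) ≤ μ((X ∩ Y) ∩ V)` — the shape of the Harris hypotheses of
`exchange_of_hats`, `exchange_of_noCross₂`, `exchange_gtrue` (`V` is up-closed, so `Y ∩ V` is). [this work] -/
theorem harris_inter_V (A b c : ℝ) (hA0 : 0 ≤ A) (hA1 : A ≤ 1) (hb0 : 0 ≤ b) (hb1 : b ≤ 1) (hc0 : 0 ≤ c) (hc1 : c ≤ 1)
    (μ : (Fin 3 → Bool) → ℝ)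
    (hμ : ∀ x, μ x = (if x 0 then A else 1 - A) * ((if x 1 then b else 1 - b) * (if x 2 then c else 1 - c)))
    (X Y : Finset (Fin 3 → Bool)) (hX : ∀ a ∈ X, ∀ b : Fin 3 → Bool, a ≤ b → b ∈ X)
    (hY : ∀ a ∈ Y, ∀ b : Fin 3 → Bool, a ≤ b → b ∈ Y) :
    (∑ x ∈ X, μ x) * (∑ x ∈ Y ∩ {![true, true, false], ![true, false, true], ![true, true, true]}, μ x)
      ≤ ∑ x ∈ (X ∩ Y) ∩ {![true, true, false], ![true, false, true], ![true, true, true]}, μ x := by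
  have h := harris_plain A b c hA0 hA1 hb0 hb1 hc0 hc1 μ hμ X _ hX (inter_up Y _ hY V_up)
  rwa [← Finset.inter_assoc] at h

/-! ## Mass table -/

/-- `μ({111}) = A·b·c`. [this work] -/
theorem mass_top (A b c : ℝ) (μ : (Fin 3 → Bool) → ℝ)
    (hμ : ∀ x, μ x = (if x 0 then A else 1 - A) * ((if x 1 then b else 1 - b) * (if x 2 then c else 1 - c))) :
    ∑ x ∈ ({![true, true, true]} : Finset (Fin 3 → Bool)), μ x = A * b * c := by
  rw [Finset.sum_singleton, hμ]; simp; ring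

/-- `μ({110, 111}) = A·b` (trace `T₁`). [this work] -/
theorem mass_T1 (A b c : ℝ) (μ : (Fin 3 → Bool) → ℝ)
    (hμ : ∀ x, μ x = (if x 0 then A else 1 - A) * ((if x 1 then b else 1 - b) * (if x 2 then c else 1 - c))) :
    ∑ x ∈ ({![true, true, false], ![true, true, true]} : Finset (Fin 3 → Bool)), μ x = A * b := by
  rw [Finset.sum_insert (by decide), Finset.sum_singleton, hμ, hμ]; simp; ring

/-- `μ({101, 111}) = A·c` (trace `T₂`). [this work] -/
theorem mass_T2 (A b c : ℝ) (μ : (Fin 3 → Bool) → ℝ)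
    (hμ : ∀ x, μ x = (if x 0 then A else 1 - A) * ((if x 1 then b else 1 - b) * (if x 2 then c else 1 - c))) :
    ∑ x ∈ ({![true, false, true], ![true, true, true]} : Finset (Fin 3 → Bool)), μ x = A * c := by
  rw [Finset.sum_insert (by decide), Finset.sum_singleton, hμ, hμ]; simp; ring

/-- `μ(V) = A(b + c − bc)`. [this work] -/
theorem mass_V (A b c : ℝ) (μ : (Fin 3 → Bool) → ℝ)
    (hμ : ∀ x, μ x = (if x 0 then A else 1 - A) * ((if x 1 then b else 1 - b) * (if x 2 then c else 1 - c))) :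
    ∑ x ∈ ({![true, true, false], ![true, false, true], ![true, true, true]} : Finset (Fin 3 → Bool)), μ x
      = A * (b + c - b * c) := by
  rw [Finset.sum_insert (by decide), Finset.sum_insert (by decide), Finset.sum_singleton, hμ, hμ, hμ]; simp; ring

/-- `μ({011, 111}) = b·c` (hat of the top trace). [this work] -/
theorem mass_hatTop (A b c : ℝ) (μ : (Fin 3 → Bool) → ℝ)
    (hμ : ∀ x, μ x = (if x 0 then A else 1 - A) * ((if x 1 then b else 1 - b) * (if x 2 then c else 1 - c))) :
    ∑ x ∈ ({![false, true, true], ![true, true, true]} : Finset (Fin 3 → Bool)), μ x = b * c := by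
  rw [Finset.sum_insert (by decide), Finset.sum_singleton, hμ, hμ]; simp; ring

/-- `μ({x₁}) = b` (hat of `T₁`). [this work] -/
theorem mass_hatT1 (A b c : ℝ) (μ : (Fin 3 → Bool) → ℝ)
    (hμ : ∀ x, μ x = (if x 0 then A else 1 - A) * ((if x 1 then b else 1 - b) * (if x 2 then c else 1 - c))) :
    ∑ x ∈ ({![false, true, false], ![true, true, false], ![false, true, true], ![true, true, true]} : Finset (Fin 3 → Bool)), μ x
      = b := by
  rw [Finset.sum_insert (by decide), Finset.sum_insert (by decide), Finset.sum_insert (by decide), Finset.sum_singleton,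
    hμ, hμ, hμ, hμ]; simp; ring

/-- `μ({x₂}) = c` (hat of `T₂`). [this work] -/
theorem mass_hatT2 (A b c : ℝ) (μ : (Fin 3 → Bool) → ℝ)
    (hμ : ∀ x, μ x = (if x 0 then A else 1 - A) * ((if x 1 then b else 1 - b) * (if x 2 then c else 1 - c))) :
    ∑ x ∈ ({![false, false, true], ![true, false, true], ![false, true, true], ![true, true, true]} : Finset (Fin 3 → Bool)), μ x
      = c := by
  rw [Finset.sum_insert (by decide), Finset.sum_insert (by decide), Finset.sum_insert (by decide), Finset.sum_singleton,
    hμ, hμ, hμ, hμ]; simp; ring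

end Summit.CriticalPhenomena.PercolationContinuityZ3.Theorems.SahiE3AndOrBlock
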